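import Summits.CriticalPhenomena.SAWScalingLimit.Theorems.SAWLoopFugacityFlowIsingBoundaryRatioWindowRectCover
import Summits.CriticalPhenomena.SAWScalingLimit.Theorems.SAWLoopFugacityFlowIsingBoundaryRatioWindowRectSquares
import HarnessLib

/-!
# Non-interleaving: exterior square chains between interleaved boundary darts meet
(line `fk-anchor-transfer`, crux `IsingBoundaryRatio`, stmt-CriticalPhenomena-10650; helper file of the stub
`windowRectPresentation_holds`)

**Theorem** (`nonInterleave`). Let `E` be a finite connected set of lattice edges, `d₀` an external dart whose
boundary-tracing orbit (`DiscreteRect.succ`) has period `N` with pairwise distinct darts `d_i = succ^[i] d₀`,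
`i < N`, and let `0 < j < l < m < N`. Let `𝒞_A`, `𝒞_B` be two DISJOINT sets of unit squares such that the
exterior squares (`DiscreteRect.quad`) of `d₀` and `d_l` are joined inside `𝒞_A`, and those of `d_j` and `d_m`
inside `𝒞_B`, by chains of side-adjacent squares each time across a side that is not in `E`. Then `False`:
the pairs `{0, l}` and `{j, m}`, interleaved along the boundary cycle, cannot both be joined "from outside"
disjointly.

Proof (winding numbers, as in `…WindowRectCover`). Close the arc of the offset boundary polygon from the bud of
`d₀` to the bud of `d_l` by the path: bud of `d_l` → midpoint of its missing edge → centre of its exterior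
square → centres of the squares of the `𝒞_A`-chain → centre of the exterior square of `d₀` → bud of `d₀`. By
`…WindowRectPolygonWinding` the winding number of this loop drops by one across the bud of `d_j` (visited by
the arc) and does not change across the bud of `d_m` (not visited); the closing path meets no test segment. The
inner test points of `d_j`, `d_m` are joined off the loop through lattice points and edges of `E`, the outer
ones through the squares of the `𝒞_B`-chain (open squares of distinct unit squares are disjoint, and the only
lattice-line points of the closing paths are axis points of non-edges whose squares are known) — contradiction.
This file: the closing sets and paths; the theorem is in `…WindowRectNonInterleave2`. [folklore]
-/

noncomputable section

open scoped Classical Real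
open Set Complex Literature.Probability.LatticeModels Literature.Probability.LatticeModels.DiscreteRect
open Literature.Topology.PlaneTopology

namespace Summit.CriticalPhenomena.SAWScalingLimit.Theorems.IsingBoundaryRatio

namespace WindowRect

variable {E : Finset (Sym2 (Site 2))}

/-! ### Squares of an edge -/

/-- If two arrows span the same edge, the exterior square of the first is one of the two squares of the
second. [folklore] -/
theorem quad_mem_of_edge_eq {x x' : Site 2} {k k' : Fin 4} (h : s(x, x + dir k) = s(x', x' + dir k')) :
    quad x k = quad x' k' ∨ quad x k = quad x' (k' + 3) := by
  rcases Sym2.eq_iff.1 h with ⟨h1, h2⟩ | ⟨h1, h2⟩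
  · rw [h1, add_right_inj] at h2
    rw [h1, dir_injective h2]
    exact Or.inl rfl
  · rw [h1, add_assoc, add_eq_left, dir_add_dir_eq_zero_iff] at h2
    rw [h2, h1, quad_add_dir_add_two]
    exact Or.inr rfl

/-! ### Centres of squares (mesh `1`) -/

/-- The centre of the unit square `g` (mesh `1`). [folklore] -/
def ctr (g : Site 2) : ℂ := framePt 1 (g, 0) (1 / 2) (1 / 2)

/-- `quad g 0 = g`. [folklore] -/
theorem quad_zero (g : Site 2) : quad g 0 = g := by rw [Site.eq_iff_two]; simp [quad]

/-- The centre of a square lies in its open square. [folklore] -/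
theorem ctr_mem_openSq (g : Site 2) : ctr g ∈ openSq 1 g := by
  have h := framePt_mem_openSq (δ := 1) (x := g) (k := 0) (a := 1 / 2) (b := 1 / 2)
    ⟨by norm_num, by norm_num⟩ ⟨by norm_num, by norm_num⟩
  rwa [quad_zero] at h

/-- The centre of the exterior square of the arrow `(x, k)` in the frame of the arrow. [folklore] -/
theorem ctr_quad (x : Site 2) (k : Fin 4) : ctr (quad x k) = framePt 1 (x, k) (1 / 2) (1 / 2) := by
  rw [ctr, ← center_frame (quad x k) k, corner_quad]

/-- The centre of the square across the `i`-th side of `a`. [folklore] -/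
theorem ctr_across (a : Site 2) (i : Fin 4) : ctr (a + dir (i + 3)) = framePt 1 (corner a i, i) (1 / 2) (-(1 / 2)) := by
  rw [ctr, ← center_across_frame a i]

/-- The centre of `a` in the frame of its `i`-th corner. [folklore] -/
theorem ctr_corner (a : Site 2) (i : Fin 4) : ctr a = framePt 1 (corner a i, i) (1 / 2) (1 / 2) := by
  rw [ctr, ← center_frame a i]

/-! ### The closing set of a family of squares -/

/-- **The closing set** of the family of squares `𝒞`: the open squares of `𝒞`, and the interior axis points
`framePt 1 (x, k) s 0`, `0 < s < 1`, of non-edges `x, x + e_k ∉ E` BOTH of whose squares are in `𝒞`. [folklore] -/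
def closingSet (E : Finset (Sym2 (Site 2))) (𝒞 : Set (Site 2)) : Set ℂ :=
  {z | (∃ g ∈ 𝒞, z ∈ openSq 1 g) ∨
    ∃ (x : Site 2) (k : Fin 4) (s : ℝ), s ∈ Ioo (0 : ℝ) 1 ∧ s(x, x + dir k) ∉ E ∧ quad x k ∈ 𝒞 ∧
      quad x (k + 3) ∈ 𝒞 ∧ z = framePt 1 (x, k) s 0}

/-- An open-square point of `𝒞` is in the closing set. [folklore] -/
theorem mem_closingSet_of_openSq {𝒞 : Set (Site 2)} {g : Site 2} (hg : g ∈ 𝒞) {z : ℂ} (hz : z ∈ openSq 1 g) :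
    z ∈ closingSet E 𝒞 := Or.inl ⟨g, hg, hz⟩

/-- **Points of the closing set lie in no open square off `𝒞`.** [folklore] -/
theorem not_mem_openSq_of_mem_closingSet {𝒞 : Set (Site 2)} {z : ℂ} (hz : z ∈ closingSet E 𝒞) {g : Site 2}
    (hg : g ∉ 𝒞) : z ∉ openSq 1 g := by
  intro h
  rcases hz with ⟨g', hg', hz'⟩ | ⟨x, k, s, -, -, -, -, rfl⟩
  · exact hg (eq_of_mem_openSq one_pos h hz' ▸ hg')
  · exact not_mem_openSq_of_mem_linePts one_pos (framePt_axis_mem_linePts x k s) g h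

/-- **Points of the closing set lie on no edge of `E`.** [folklore] -/
theorem not_mem_edge_of_mem_closingSet (hE : ∀ e ∈ E, e ∈ (zdGraph 2).edgeSet) {𝒞 : Set (Site 2)} {z : ℂ}
    (hz : z ∈ closingSet E 𝒞) {v w : Site 2} (hvw : s(v, w) ∈ E)
    (h : z ∈ segment ℝ (meshPoint 1 v) (meshPoint 1 w)) : False := by
  rcases hz with ⟨g', -, hz'⟩ | ⟨x, k, s, hs, hxk, -, -, rfl⟩
  · exact not_mem_openSq_of_mem_linePts one_pos (mem_linePts_of_mem_edge' one_pos hE hvw h) _ hz'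
  · exact axisPt_not_mem_edge one_pos hE hxk hs hvw h

/-- An interior axis point is not a lattice point. [folklore] -/
theorem framePt_axis_ne_meshPoint {x : Site 2} {k : Fin 4} {s : ℝ} (hs : s ∈ Ioo (0 : ℝ) 1) (y : Site 2) :
    framePt 1 (x, k) s 0 ≠ meshPoint 1 y := by
  intro h
  have h1 : framePt 1 (x, k) s 0 ∈ segment ℝ (meshPoint 1 y) (meshPoint 1 (y + dir k)) := by
    rw [h]; exact left_mem_segment _ _ _
  have h2 : framePt 1 (x, k) s 0 ∈ segment ℝ (meshPoint 1 y) (meshPoint 1 (y + dir (k + 1))) := by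
    rw [h]; exact left_mem_segment _ _ _
  have e1 := edge_eq_of_axisPt_mem_segment one_pos hs (zdGraph_adj_add_dir y k) h1
  have e2 := edge_eq_of_axisPt_mem_segment one_pos hs (zdGraph_adj_add_dir y (k + 1)) h2
  rw [← e2] at e1
  rcases Sym2.eq_iff.1 e1 with ⟨-, h3⟩ | ⟨h3, -⟩
  · rw [add_right_inj] at h3
    have h4 : k = k + 1 := dir_injective h3
    have : ∀ k : Fin 4, k ≠ k + 1 := by decide
    exact this k h4
  · exact add_dir_ne y (k + 1) h3.symm

/-- **Points of the closing set are not lattice points.** [folklore] -/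
theorem meshPoint_not_mem_closingSet {𝒞 : Set (Site 2)} (y : Site 2) : meshPoint 1 y ∉ closingSet E 𝒞 := by
  rintro (⟨g', -, hz'⟩ | ⟨x, k, s, hs, -, -, -, h⟩)
  · exact not_mem_openSq_of_mem_linePts one_pos (meshPoint_mem_linePts y) _ hz'
  · exact framePt_axis_ne_meshPoint hs y h.symm

/-- An interior axis point of an edge lies on the closed segment of that edge. [folklore] -/
theorem framePt_axis_mem_segment {x : Site 2} {k : Fin 4} {s : ℝ} (hs : s ∈ Ioo (0 : ℝ) 1) :
    framePt 1 (x, k) s 0 ∈ segment ℝ (meshPoint 1 x) (meshPoint 1 (x + dir k)) := by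
  rw [← framePt_origin x k, ← framePt_far x k, segment_eq_image_lineMap]
  refine ⟨s, ⟨hs.1.le, hs.2.le⟩, ?_⟩
  rw [framePt_lineMap_fst]; congr 1
  ring

/-- **Two closing sets over disjoint families of squares are disjoint.** [folklore] -/
theorem disjoint_closingSet {𝒞 𝒞' : Set (Site 2)} (hdis : Disjoint 𝒞 𝒞') {z : ℂ} (hz : z ∈ closingSet E 𝒞)
    (hz' : z ∈ closingSet E 𝒞') : False := by
  rcases hz' with ⟨g', hg', hzg'⟩ | ⟨x', k', s', hs', -, hq', hq3', rfl⟩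
  · exact not_mem_openSq_of_mem_closingSet hz (fun h => Set.disjoint_left.1 hdis h hg') hzg'
  · rcases hz with ⟨g, hg, hzg⟩ | ⟨x, k, s, hs, -, hq, -, h⟩
    · exact not_mem_openSq_of_mem_linePts one_pos (framePt_axis_mem_linePts x' k' s') g hzg
    · have hmem : framePt 1 (x', k') s' 0 ∈ segment ℝ (meshPoint 1 x) (meshPoint 1 (x + dir k)) := by
        rw [h]; exact framePt_axis_mem_segment hs
      have he := edge_eq_of_axisPt_mem_segment one_pos hs' (zdGraph_adj_add_dir x k) hmem
      rcases quad_mem_of_edge_eq he with h1 | h1 <;> rw [h1] at hq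
      · exact Set.disjoint_left.1 hdis hq hq'
      · exact Set.disjoint_left.1 hdis hq hq3'

/-- **An interior axis point of a missing edge whose exterior square is off `𝒞'` is not in the closing set
of `𝒞'`**, provided the square across is off `𝒞'` too, or more simply: provided the exterior square is off
`𝒞'` (the closing set only contains axis points both of whose squares are in `𝒞'`). [folklore] -/
theorem framePt_axis_not_mem_closingSet {𝒞' : Set (Site 2)} {x : Site 2} {k : Fin 4} (hq : quad x k ∉ 𝒞')
    {s : ℝ} (hs : s ∈ Ioo (0 : ℝ) 1) : framePt 1 (x, k) s 0 ∉ closingSet E 𝒞' := by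
  rintro (⟨g', hg', hzg'⟩ | ⟨x', k', s', hs', -, hq', hq3', h⟩)
  · exact not_mem_openSq_of_mem_linePts one_pos (framePt_axis_mem_linePts x k s) g' hzg'
  · have hmem : framePt 1 (x, k) s 0 ∈ segment ℝ (meshPoint 1 x') (meshPoint 1 (x' + dir k')) := by
      rw [h]; exact framePt_axis_mem_segment hs'
    have he := edge_eq_of_axisPt_mem_segment one_pos hs (zdGraph_adj_add_dir x' k') hmem
    rcases quad_mem_of_edge_eq he.symm with h1 | h1 <;> rw [h1] at hq
    · exact hq hq'
    · exact hq hq3'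

/-! ### The chain path through a family of squares -/

/-- One step across a side: the segment between the two centres lies in the closing set, provided both squares
are in `𝒞` and the side is not in `E`. [folklore] -/
theorem segment_ctr_subset_closingSet {𝒞 : Set (Site 2)} {a : Site 2} {i : Fin 4} (ha : a ∈ 𝒞)
    (hb : a + dir (i + 3) ∈ 𝒞) (hne : s(corner a i, corner a i + dir i) ∉ E) :
    segment ℝ (ctr a) (ctr (a + dir (i + 3))) ⊆ closingSet E 𝒞 := by
  intro z hz
  rw [ctr_corner a i, ctr_across] at hz
  rcases across_cases one_pos hz with h | h | rfl
  · exact mem_closingSet_of_openSq ha h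
  · exact mem_closingSet_of_openSq hb h
  · refine Or.inr ⟨corner a i, i, 1 / 2, ⟨by norm_num, by norm_num⟩, hne, ?_, ?_, rfl⟩
    · rwa [quad_corner]
    · rwa [quad_add_three_eq, quad_corner]

/-- **The chain path.** Two squares joined inside `𝒞` by steps across sides not in `E` have their centres
joined by a path inside any set `S` containing the centres of the squares of `𝒞` and the segments between the
centres of side-adjacent squares of `𝒞` across sides not in `E`. [folklore] -/
theorem exists_path_ctr {𝒞 : Set (Site 2)} {S : Set ℂ} (hctr : ∀ a ∈ 𝒞, ctr a ∈ S)
    (hseg : ∀ (a : Site 2) (i : Fin 4), a ∈ 𝒞 → a + dir (i + 3) ∈ 𝒞 → s(corner a i, corner a i + dir i) ∉ E →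
      segment ℝ (ctr a) (ctr (a + dir (i + 3))) ⊆ S)
    {a b : Site 2} (ha : a ∈ 𝒞)
    (h : Relation.ReflTransGen (fun p q : Site 2 => p ∈ 𝒞 ∧ q ∈ 𝒞 ∧ ∃ i : Fin 4, q = p + dir (i + 3) ∧
      s(corner p i, corner p i + dir i) ∉ E) a b) :
    ∃ P : Path (ctr a) (ctr b), ∀ z ∈ range P, z ∈ S := by
  induction h with
  | refl => exact ⟨Path.refl _, by rintro z ⟨t, rfl⟩; exact hctr a ha⟩
  | @tail p q _ hpq ih =>
    obtain ⟨P, hP⟩ := ih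
    obtain ⟨hp, hq, i, rfl, hne⟩ := hpq
    refine ⟨P.trans (Path.segment (ctr p) (ctr (p + dir (i + 3)))), fun z hz => ?_⟩
    rw [Path.trans_range, Path.range_segment] at hz
    rcases hz with hz | hz
    · exact hP z hz
    · exact hseg p i hp hq hne hz

/-- Points of the segment between the centres of two side-adjacent squares are centre-line points
`framePt 1 (corner a i, i) (1/2) c`, `|c| ≤ 1/2`. [folklore] -/
theorem exists_of_mem_segment_ctr {a : Site 2} {i : Fin 4} {z : ℂ} (hz : z ∈ segment ℝ (ctr a) (ctr (a + dir (i + 3)))) :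
    ∃ c : ℝ, |c| ≤ 1 / 2 ∧ z = framePt 1 (corner a i, i) (1 / 2) c := by
  rw [ctr_corner a i, ctr_across, segment_symm] at hz
  obtain ⟨c, hc, rfl⟩ := exists_of_mem_segment_snd (by norm_num) hz
  exact ⟨c, abs_le.2 ⟨by linarith [hc.1], hc.2⟩, rfl⟩

/-! ### The closing pieces at a dart: bud → midpoint of the missing edge → centre of the exterior square -/

/-- Points of the first closing piece (bud to midpoint) are interior axis points of the missing edge with
parameter in `[1/4, 1/2]`. [folklore] -/
theorem mem_segment_bud_mid {d : Site 2 × Fin 4} {z : ℂ}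
    (hz : z ∈ segment ℝ (framePt 1 d (1 / 4) 0) (framePt 1 d (1 / 2) 0)) :
    ∃ s ∈ Icc (1 / 4 : ℝ) (1 / 2), z = framePt 1 d s 0 :=
  exists_of_mem_segment_fst (by norm_num) hz

/-- Points of the second closing piece (midpoint to centre) are the midpoint or open-square points of the
exterior square. [folklore] -/
theorem mem_segment_mid_ctr {x : Site 2} {k : Fin 4} {z : ℂ}
    (hz : z ∈ segment ℝ (framePt 1 (x, k) (1 / 2) 0) (ctr (quad x k))) :
    z = framePt 1 (x, k) (1 / 2) 0 ∨ z ∈ openSq 1 (quad x k) := by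
  rw [ctr_quad] at hz
  obtain ⟨c, hc, rfl⟩ := exists_of_mem_segment_snd (by norm_num) hz
  rcases hc.1.eq_or_lt with h | h
  · left; rw [← h]
  · right; exact framePt_mem_openSq ⟨by norm_num, by norm_num⟩ ⟨h, by linarith [hc.2]⟩

/-! ### The arc is part of the polygon -/

/-- The polygon from `d` through `n ≤ m` steps is part of the polygon through `m` steps. [folklore] -/
theorem range_arcPath_mono {δ η : ℝ} (d : Site 2 × Fin 4) {n m : ℕ} (h : n ≤ m) :
    range (arcPath E δ η d n) ⊆ range (arcPath E δ η d m) := by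
  induction n generalizing d m with
  | zero =>
    rw [range_arcPath_zero]
    rintro _ rfl
    exact ⟨0, by simp⟩
  | succ n ih =>
    obtain ⟨m, rfl⟩ : ∃ m', m = m' + 1 := ⟨m - 1, by omega⟩
    rw [range_arcPath_succ, range_arcPath_succ]
    exact union_subset_union_right _ (ih (succ E d) (by omega))

/-! ### Points near a lattice point and points of edges avoid the closing sets -/

/-- A frame point `framePt 1 (x, k) a b` with `0 < a, b < 1` off the closing set of a family not containing
its square. [folklore] -/
theorem framePt_not_mem_closingSet {𝒞 : Set (Site 2)} {x : Site 2} {k : Fin 4} (hq : quad x k ∉ 𝒞) {a b : ℝ}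
    (ha : a ∈ Ioo (0 : ℝ) 1) (hb : b ∈ Ioo (0 : ℝ) 1) : framePt 1 (x, k) a b ∉ closingSet E 𝒞 := fun h =>
  not_mem_openSq_of_mem_closingSet h hq (framePt_mem_openSq ha hb)

/-- The allowed set of the closing path at the darts `dl`, `d0` over the family `𝒞`: the closing set, and the
interior axis points of the two missing edges. [folklore] -/
def closingSet' (E : Finset (Sym2 (Site 2))) (𝒞 : Set (Site 2)) (dl d0 : Site 2 × Fin 4) : Set ℂ :=
  closingSet E 𝒞 ∪ {z | ∃ s ∈ Ioo (0 : ℝ) 1, z = framePt 1 dl s 0 ∨ z = framePt 1 d0 s 0}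

/-- A frame point with `0 < a, b < 1` off `closingSet'` of a family not containing its square. [folklore] -/
theorem framePt_not_mem_closingSet' {𝒞 : Set (Site 2)} {dl d0 : Site 2 × Fin 4} {x : Site 2} {k : Fin 4}
    (hq : quad x k ∉ 𝒞) {a b : ℝ} (ha : a ∈ Ioo (0 : ℝ) 1) (hb : b ∈ Ioo (0 : ℝ) 1) :
    framePt 1 (x, k) a b ∉ closingSet' E 𝒞 dl d0 := by
  rintro (h | ⟨s, -, h | h⟩)
  · exact framePt_not_mem_closingSet hq ha hb h
  · exact not_mem_openSq_of_mem_linePts one_pos (h ▸ framePt_axis_mem_linePts dl.1 dl.2 s) _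
      (framePt_mem_openSq ha hb)
  · exact not_mem_openSq_of_mem_linePts one_pos (h ▸ framePt_axis_mem_linePts d0.1 d0.2 s) _
      (framePt_mem_openSq ha hb)

/-- Lattice points are off `closingSet'`. [folklore] -/
theorem meshPoint_not_mem_closingSet' {𝒞 : Set (Site 2)} {dl d0 : Site 2 × Fin 4} (y : Site 2) :
    meshPoint 1 y ∉ closingSet' E 𝒞 dl d0 := by
  rintro (h | ⟨s, hs, h | h⟩)
  · exact meshPoint_not_mem_closingSet y h
  · exact framePt_axis_ne_meshPoint (x := dl.1) (k := dl.2) hs y h.symm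
  · exact framePt_axis_ne_meshPoint (x := d0.1) (k := d0.2) hs y h.symm

/-- Points of edges of `E` are off `closingSet'` (the two darts being external). [folklore] -/
theorem not_mem_closingSet'_of_mem_edge (hE : ∀ e ∈ E, e ∈ (zdGraph 2).edgeSet) {𝒞 : Set (Site 2)}
    {dl d0 : Site 2 × Fin 4} (hdl : IsExtDart E dl) (hd0 : IsExtDart E d0) {v w : Site 2} (hvw : s(v, w) ∈ E)
    {z : ℂ} (hz : z ∈ segment ℝ (meshPoint 1 v) (meshPoint 1 w)) : z ∉ closingSet' E 𝒞 dl d0 := by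
  rintro (h | ⟨s, hs, rfl | rfl⟩)
  · exact not_mem_edge_of_mem_closingSet hE h hvw hz
  · exact axisPt_not_mem_edge one_pos hE hdl.2 hs hvw hz
  · exact axisPt_not_mem_edge one_pos hE hd0.2 hs hvw hz

end WindowRect

/-- **Two closing sets over disjoint families of squares are disjoint**, closed form (registered sub-goal of
stmt-CriticalPhenomena-10650). [folklore] -/
theorem windowRect_disjoint_closingSet : ∀ {E : Finset (Sym2 (Site 2))} {𝒞 𝒞' : Set (Site 2)}, Disjoint 𝒞 𝒞' → ∀ {z : ℂ}, z ∈ WindowRect.closingSet E 𝒞 → z ∈ WindowRect.closingSet E 𝒞' → False :=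
  fun hdis _ hz hz' => WindowRect.disjoint_closingSet hdis hz hz'

end Summit.CriticalPhenomena.SAWScalingLimit.Theorems.IsingBoundaryRatio

end
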